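import Summits.CriticalPhenomena.PercolationContinuityZ3.Theorems.PercNearOneGluingNoHeavyLowerTailSunflowerSafePartition
import Summits.CriticalPhenomena.PercolationContinuityZ3.Theorems.PercNearOneGluingNoHeavyLowerTailSunflowerCoverConjecture
import HarnessLib

/-!
# `NoHeavyLowerTail` (crux stmt-CriticalPhenomena-4575), abstract sunflower cubic: THE CONJECTURE "SAFE ⟹ COVER" IS FALSE

Support file (seat `prim-ineq-prove-1` gen 37; `--supports stmt-CriticalPhenomena-4575`).  No `sorry`, no named facts; the
finite checks are kernel `decide`s (no `native_decide`).  Memo: run/shared/lean/prim/prim-ineq-prove-1/FINDING-TROPICAL-prove1-g37.md §1.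

THE COUNTEREXAMPLE.  The FAN CORE `A = x₀x₁ ∨ x₀x₂ ∨ x₀x₃ ∨ x₁x₂x₃` on four points (its clutter of minimal transversals
`𝒯 = {01, 02, 03, 123}` equals its clutter of generators) at the uniform product measure `p ≡ 1/32`:
* `Fan.safe_core` — `A` is SAFE (`SafeCalc.Safe`): by `…SunflowerSafePartition` safety is the finite partition test on `𝒯`;
  two sub-families are Harris, three and four sub-families are the integer inequalities `Fan.N3`, `Fan.N4` on the numerators
  `Fan.Nfin u = 32⁴ · famIn {C j | j ∈ u}` (`Fan.famIn_image`; worst ratio `0.476`);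
* `Fan.not_cover` — `A` does NOT have the cover property `SafeCalc.Cover p univ 𝒯` of `…SunflowerCoverGraded`: for the five
  allowed families `{123}, {123}, {02,03}, {01,03}, {01,02}` (every transversal in exactly two of them, `K − m = 3`)
  `∏ famIn = 1.5047… · famIn(∅)³` (`Fan.NC`);
* **`not_coverOfSafe : ¬ CoverOfSafe`** — the conjecture of `…SunflowerCoverConjecture` (memo g36 §7) is false.
HOW IT WAS FOUND (memo §2): in the valuation ("tropical") limit `p_e = ε^{a_e}` the hitting function becomes the min-cost
hitting-set number `τ`; COVER is core-nonemptiness of the deficiency game (Bondareva–Shapley) and fails for `{01,02,03,123}` with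
unit costs (`τ(𝒯) = 2`, fractional cover value `5/3`), while the partition inequalities of SAFE hold with constants `4/9 < 1`.
The pentagon core `x₁x₃ ∨ x₂x₄ ∨ x₃x₅ ∨ x₄x₁ ∨ x₅x₂` (safe for EVERY product measure, census g34 §6) fails COVER for uniform
`p < 0.0095` in the same way (memo §1).  Graded safety of both cores holds numerically; indeed SAFE ⟹ GRADED SAFE holds in every
tropical limit (memo §3, the grouping lemma), so `COVER` is strictly stronger than graded safety and the Hölder route of
`…SunflowerCoverGraded` cannot settle "SAFE ⟹ GS" in general.
-/

noncomputable section

namespace Summit.CriticalPhenomena.PercolationContinuityZ3.Theorems.SunflowerPartition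

namespace SafeCalc

open MeasureTheory Finset
open Literature.Probability.LatticeModels Literature.Probability.Percolation
open TwoGenCore (wmiss)

namespace Fan

/-! ## The four-point fan core and its data -/

/-- The four minimal transversals of the fan core — which are also its four generators (the clutter `{01, 02, 03, 123}` is
self-blocking). [this work] -/
def C : Fin 4 → Finset (Fin 4) := ![{0, 1}, {0, 2}, {0, 3}, {1, 2, 3}]

/-- The family of minimal transversals of the fan core. [this work] -/
def 𝒯 : Finset (Finset (Fin 4)) := univ.image C

/-- The FAN CORE `x₀x₁ ∨ x₀x₂ ∨ x₀x₃ ∨ x₁x₂x₃` as an event of the four-point cube. [this work] -/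
def core : Set (Set (Fin 4)) := {ω | ∃ j, (↑(C j) : Set (Fin 4)) ⊆ ω}

/-- The uniform parameter `1/32`. [this work] -/
def p32 : Fin 4 → unitInterval := fun _ => ⟨1 / 32, by norm_num⟩

/-- Integer numerators of the hitting function: `Nfin u = 32⁴ · famIn p32 univ 𝒯 {C j | j ∈ u}` (`famIn_image`): the sum over the
missing sets `T` all of whose contained transversals are allowed of `31^{#T}`. [this work] -/
def Nfin (u : Finset (Fin 4)) : ℕ :=
  ∑ T ∈ (univ : Finset (Fin 4)).powerset, if (∀ j, C j ⊆ T → j ∈ u) then 31 ^ T.card else 0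

/-- The transversals are pairwise distinct. [this work] -/
theorem C_injective : Function.Injective C := by decide

/-- `#𝒯 = 4`. [this work] -/
theorem card_𝒯 : 𝒯.card = 4 := by
  rw [𝒯, card_image_of_injective _ C_injective, card_univ, Fintype.card_fin]

/-- Cylinder weights at the uniform parameter `1/32`. [this work] -/
theorem wmiss_p32 (T : Finset (Fin 4)) : wmiss p32 univ T = (31 : ℝ) ^ T.card / 32 ^ 4 := by
  have hc : T.card ≤ 4 := by simpa using card_le_univ T
  unfold TwoGenCore.wmiss
  have hp : ∀ e, ((p32 e : unitInterval) : ℝ) = 1 / 32 := fun e => rfl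
  simp only [hp, prod_const, card_univ_sdiff, Fintype.card_fin]
  rw [show (1 : ℝ) - 1 / 32 = 31 / 32 by norm_num, div_pow, div_pow, one_pow, div_mul_div_comm, mul_one, ← pow_add,
    Nat.add_sub_cancel' hc]

/-- **The hitting function of the fan core in integers**: `famIn p32 univ 𝒯 (u.image C) = Nfin u / 32⁴`. [this work] -/
theorem famIn_image (u : Finset (Fin 4)) : famIn p32 univ 𝒯 (u.image C) = (Nfin u : ℝ) / 32 ^ 4 := by
  unfold famIn BEx Nfin
  rw [Nat.cast_sum, sum_div]
  refine sum_congr rfl fun T _ => ?_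
  have hcond : (∀ D ∈ 𝒯, D ⊆ T → D ∈ u.image C) ↔ (∀ j, C j ⊆ T → j ∈ u) := by
    unfold 𝒯
    simp only [mem_image, mem_univ, true_and, forall_exists_index, forall_apply_eq_imp_iff]
    refine forall_congr' fun j => imp_congr_right fun _ => ⟨?_, fun hj => ⟨j, hj, rfl⟩⟩
    rintro ⟨i, hi, hij⟩
    rwa [← C_injective hij]
  rw [wmiss_p32]
  dsimp only
  by_cases h : ∀ j, C j ⊆ T → j ∈ u
  · rw [if_pos (hcond.2 h), if_pos h]; push_cast; ring
  · rw [if_neg (fun h' => h (hcond.1 h')), if_neg h]; push_cast; ring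

/-- `famIn ∅` in integers. [this work] -/
theorem famIn_empty_eq : famIn p32 univ 𝒯 ∅ = (Nfin ∅ : ℝ) / 32 ^ 4 := by
  rw [← famIn_image ∅, image_empty]

/-! ## The finite checks (kernel `decide`) -/

/-- Three nonempty pairwise disjoint sub-families: `∏ N ≤ N(∅)² · 32⁴`. [this work] -/
theorem N3 : ∀ u₀ : Finset (Fin 4), u₀.Nonempty → ∀ u₁ : Finset (Fin 4), u₁.Nonempty → Disjoint u₀ u₁ →
    ∀ u₂ : Finset (Fin 4), u₂.Nonempty → Disjoint u₀ u₂ → Disjoint u₁ u₂ →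
      Nfin u₀ * Nfin u₁ * Nfin u₂ ≤ Nfin ∅ ^ 2 * 32 ^ 4 := by
  decide

/-- Four nonempty pairwise disjoint sub-families: `∏ N ≤ N(∅)³ · 32⁴`. [this work] -/
theorem N4 : ∀ u₀ : Finset (Fin 4), u₀.Nonempty → ∀ u₁ : Finset (Fin 4), u₁.Nonempty → Disjoint u₀ u₁ →
    ∀ u₂ : Finset (Fin 4), u₂.Nonempty → Disjoint u₀ u₂ → Disjoint u₁ u₂ →
      ∀ u₃ : Finset (Fin 4), u₃.Nonempty → Disjoint u₀ u₃ → Disjoint u₁ u₃ → Disjoint u₂ u₃ →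
        Nfin u₀ * Nfin u₁ * Nfin u₂ * Nfin u₃ ≤ Nfin ∅ ^ 3 * 32 ^ 4 := by
  decide

/-- The COVER inequality FAILS for the family `{123}, {123}, {02,03}, {01,03}, {01,02}` (`K = 5`, multiplicity `2`):
`N(∅)³ · 32⁸ < ∏ N` (ratio ≈ 1.505). [this work] -/
theorem NC : Nfin ∅ ^ 3 * 32 ^ 8 < Nfin {3} * Nfin {3} * Nfin {1, 2} * Nfin {0, 2} * Nfin {0, 1} := by
  decide

/-- `N(∅) = 3008 > 0` (so `μ(core) = 3008 / 32⁴ ≈ 0.00287`). [this work] -/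
theorem Nfin_empty : Nfin ∅ = 3008 := by decide

/-! ## The hypotheses of `CoverOfSafe` for the fan core -/

/-- The fan core is determined by the (whole) block. [this work] -/
theorem determinedBy_core : DeterminedBy core (↑(univ : Finset (Fin 4)) : Set (Fin 4)) := by
  rw [determinedBy_iff]
  intro ω ω' h
  rw [coe_univ, Set.inter_univ, Set.inter_univ] at h
  rw [h]

/-- The fan core is an up-set. [this work] -/
theorem isUpperSet_core : IsUpperSet core := by
  rintro ω ω' hle ⟨j, hj⟩
  exact ⟨j, hj.trans hle⟩

/-- The members of `𝒯` lie in the block. [this work] -/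
theorem 𝒯_subset : ∀ D ∈ 𝒯, D ⊆ (univ : Finset (Fin 4)) := fun D _ => subset_univ D

/-- Every member of `𝒯` is bad (a transversal). [this work] -/
theorem 𝒯_bad : ∀ D ∈ 𝒯, ((univ \ D : Finset (Fin 4)) : Set (Fin 4)) ∉ core := by
  have key : ∀ j i : Fin 4, ¬ C i ⊆ univ \ C j := by decide
  intro D hD
  unfold 𝒯 at hD
  rw [mem_image] at hD
  obtain ⟨j, -, rfl⟩ := hD
  rintro ⟨i, hi⟩
  exact key j i (Finset.coe_subset.1 hi)

/-- `𝒯` covers every bad missing set. [this work] -/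
theorem 𝒯_cover : ∀ T, T ⊆ (univ : Finset (Fin 4)) → ((univ \ T : Finset (Fin 4)) : Set (Fin 4)) ∉ core →
    ∃ D ∈ 𝒯, D ⊆ T := by
  have key : ∀ T : Finset (Fin 4), (∀ i, ¬ C i ⊆ univ \ T) → ∃ j, C j ⊆ T := by decide
  intro T _ hT
  have h1 : ∀ i, ¬ C i ⊆ univ \ T := fun i hi => hT ⟨i, Finset.coe_subset.2 hi⟩
  obtain ⟨j, hj⟩ := key T h1
  exact ⟨C j, mem_image_of_mem C (mem_univ j), hj⟩

/-- `μ(core) = famIn ∅`. [this work] -/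
theorem real_core : (prodBernoulli p32).real core = famIn p32 univ 𝒯 ∅ := by
  refine (famIn_empty p32 univ determinedBy_core 𝒯 (fun D hD T _ hDT hTA => 𝒯_bad D hD ?_) 𝒯_cover).symm
  exact isUpperSet_core (Finset.coe_subset.2 (sdiff_subset_sdiff (subset_refl _) hDT)) hTA

/-- `μ(core) > 0`. [this work] -/
theorem real_core_pos : 0 < (prodBernoulli p32).real core := by
  rw [real_core, famIn_empty_eq, Nfin_empty]; norm_num

/-! ## The fan core is safe at `p = 1/32` -/

/-- Arithmetic: three factors. [this work] -/
theorem div_three_le {x y z w B : ℝ} (hB : 0 < B) (h : x * y * z ≤ w ^ 2 * B) :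
    x / B * (y / B) * (z / B) ≤ (w / B) ^ 2 := by
  have e1 : x / B * (y / B) * (z / B) = x * y * z / (B ^ 2 * B) := by
    field_simp
  have e2 : (w / B) ^ 2 = w ^ 2 * B / (B ^ 2 * B) := by
    field_simp
  rw [e1, e2]
  exact div_le_div_of_nonneg_right h (by positivity)

/-- Arithmetic: four factors. [this work] -/
theorem div_four_le {x y z v w B : ℝ} (hB : 0 < B) (h : x * y * z * v ≤ w ^ 3 * B) :
    x / B * (y / B) * (z / B) * (v / B) ≤ (w / B) ^ 3 := by
  have e1 : x / B * (y / B) * (z / B) * (v / B) = x * y * z * v / (B ^ 3 * B) := by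
    field_simp
  have e2 : (w / B) ^ 3 = w ^ 3 * B / (B ^ 3 * B) := by
    field_simp
  rw [e1, e2]
  exact div_le_div_of_nonneg_right h (by positivity)

/-- **The fan core is SAFE at the uniform parameter `1/32`** (finite partition test: Harris for two sub-families, `N3`, `N4`).
[this work] -/
theorem safe_core : Safe p32 core := by
  have hh : 0 < famIn p32 univ 𝒯 ∅ := by rw [famIn_empty_eq, Nfin_empty]; norm_num
  refine safe_of_disjoint_famIn p32 univ determinedBy_core isUpperSet_core 𝒯 𝒯_subset 𝒯_bad 𝒯_cover
    (disjoint_famIn_of_nonempty p32 univ 𝒯 hh ?_)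
  intro k hk 𝒰 hsub hne hdisj
  rw [card_𝒯] at hk
  -- codes of the sub-families
  let u : Fin k → Finset (Fin 4) := fun i => univ.filter fun j => C j ∈ 𝒰 i
  have hU : ∀ i, 𝒰 i = (u i).image C := by
    intro i
    ext D
    simp only [u, mem_image, mem_filter, mem_univ, true_and]
    constructor
    · intro hD
      have hD𝒯 := hsub i hD
      unfold 𝒯 at hD𝒯
      obtain ⟨j, -, rfl⟩ := mem_image.1 hD𝒯
      exact ⟨j, hD, rfl⟩
    · rintro ⟨j, hj, rfl⟩; exact hj
  have hfam : ∀ i, famIn p32 univ 𝒯 (𝒰 i) = (Nfin (u i) : ℝ) / 32 ^ 4 := fun i => by rw [hU i, famIn_image]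
  have hune : ∀ i, (u i).Nonempty := by
    intro i
    obtain ⟨D, hD⟩ := hne i
    rw [hU i, mem_image] at hD
    obtain ⟨j, hj, -⟩ := hD
    exact ⟨j, hj⟩
  have hud : ∀ i i', i ≠ i' → Disjoint (u i) (u i') := by
    intro i i' hii'
    rw [Finset.disjoint_left]
    intro j hj hj'
    simp only [u, mem_filter, mem_univ, true_and] at hj hj'
    exact Finset.disjoint_left.1 (hdisj i i' hii') hj hj'
  have hB : (0 : ℝ) < 32 ^ 4 := by norm_num
  interval_cases k
  · simp
  · rw [Fin.prod_univ_one, pow_zero]; exact famIn_le_one _ _ _ _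
  · rw [Fin.prod_univ_two, pow_one]
    exact famIn_two_le p32 univ 𝒯_subset (hdisj 0 1 (by decide))
  · rw [Fin.prod_univ_three, hfam, hfam, hfam, famIn_empty_eq]
    have h3 := N3 (u 0) (hune 0) (u 1) (hune 1) (hud 0 1 (by decide)) (u 2) (hune 2) (hud 0 2 (by decide))
      (hud 1 2 (by decide))
    exact div_three_le hB (by exact_mod_cast h3)
  · rw [Fin.prod_univ_four, hfam, hfam, hfam, hfam, famIn_empty_eq]
    have h4 := N4 (u 0) (hune 0) (u 1) (hune 1) (hud 0 1 (by decide)) (u 2) (hune 2) (hud 0 2 (by decide))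
      (hud 1 2 (by decide)) (u 3) (hune 3) (hud 0 3 (by decide)) (hud 1 3 (by decide)) (hud 2 3 (by decide))
    exact div_four_le hB (by exact_mod_cast h4)

/-! ## The cover property fails: `CoverOfSafe` is false -/

/-- The violating family (in the "allowed" language): `{123}, {123}, {02,03}, {01,03}, {01,02}`, every transversal in at most two
members; its codes. [this work] -/
def code : Fin 5 → Finset (Fin 4) := ![{3}, {3}, {1, 2}, {0, 2}, {0, 1}]

/-- Every transversal lies in at most two members of the violating family. [this work] -/
theorem code_mult : ∀ j : Fin 4, (univ.filter fun k : Fin 5 => j ∈ code k).card ≤ 2 := by decide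

/-- **The fan core at `p = 1/32` does NOT have the cover property.** [this work] -/
theorem not_cover : ¬ Cover p32 (univ : Finset (Fin 4)) 𝒯 := by
  intro hcov
  have h := hcov 5 2 (fun k => (code k).image C) ?_
  · rw [Fin.prod_univ_five, famIn_image, famIn_image, famIn_image, famIn_image, famIn_image, famIn_empty_eq] at h
    have hlt : ((Nfin ∅ : ℕ) : ℝ) ^ 3 * 32 ^ 8 <
        (Nfin (code 0) : ℝ) * Nfin (code 1) * Nfin (code 2) * Nfin (code 3) * Nfin (code 4) := by
      have := NC
      simp only [code]
      exact_mod_cast this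
    have hB : (0 : ℝ) < 32 ^ 4 := by norm_num
    have key : (Nfin (code 0) : ℝ) / 32 ^ 4 * ((Nfin (code 1) : ℝ) / 32 ^ 4) * ((Nfin (code 2) : ℝ) / 32 ^ 4) *
        ((Nfin (code 3) : ℝ) / 32 ^ 4) * ((Nfin (code 4) : ℝ) / 32 ^ 4) =
        ((Nfin (code 0) : ℝ) * Nfin (code 1) * Nfin (code 2) * Nfin (code 3) * Nfin (code 4)) / (32 ^ 4) ^ 5 := by
      field_simp
    have key2 : (((Nfin ∅ : ℕ) : ℝ) / 32 ^ 4) ^ (5 - 2) = ((Nfin ∅ : ℕ) : ℝ) ^ 3 * 32 ^ 8 / (32 ^ 4) ^ 5 := by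
      norm_num [div_pow]
      ring
    rw [key, key2] at h
    have h' := (div_le_div_iff_of_pos_right (by positivity : (0:ℝ) < (32 ^ 4) ^ 5)).1 h
    linarith
  · intro D hD
    unfold 𝒯 at hD
    obtain ⟨j, -, rfl⟩ := mem_image.1 hD
    have : (univ.filter fun k : Fin 5 => C j ∈ (code k).image C) = univ.filter fun k : Fin 5 => j ∈ code k := by
      refine filter_congr fun k _ => ?_
      rw [mem_image]
      exact ⟨fun ⟨i, hi, hij⟩ => by rwa [← C_injective hij], fun hj => ⟨j, hj, rfl⟩⟩
    rw [this]
    exact code_mult j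

end Fan

/-- **`CoverOfSafe` IS FALSE**: the fan core `x₀x₁ ∨ x₀x₂ ∨ x₀x₃ ∨ x₁x₂x₃` on four points at the uniform parameter `1/32` is
safe (`Fan.safe_core`) but does not have the cover property (`Fan.not_cover`: for the five allowed families
`{123},{123},{02,03},{01,03},{01,02}` of multiplicity two, `∏ famIn = 1.505… · famIn(∅)³`). [this work] -/
theorem not_coverOfSafe : ¬ CoverOfSafe := fun hconj =>
  Fan.not_cover (hconj (Fin 4) Fan.p32 univ Fan.core Fan.𝒯 Fan.determinedBy_core Fan.isUpperSet_core
    Fan.real_core_pos Fan.𝒯_subset Fan.𝒯_bad Fan.𝒯_cover Fan.safe_core)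

end SafeCalc

end Summit.CriticalPhenomena.PercolationContinuityZ3.Theorems.SunflowerPartition
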